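import Mathlib
import HarnessLib
import Summits.Langlands.Langlands.Theses.QuadraticWindow
import Literature.NumberTheory.Automorphic.UnitaryCoherentGaloisRep
import Literature.NumberTheory.Automorphic.MokWeakBaseChange
import Literature.NumberTheory.GaloisRepresentations.GaloisRepOfAlgebraValuedLimit
import Summits.Langlands.Langlands.Theorems.QuadraticWindowGaloisRepOfUnitaryLDSAlmostAllUnramified

/-!
# The crux `GaloisRepOfUnitaryLDS` (stmt-Langlands-15129) from its printed inputs — line `Sketch`
# (card `hecke-algebra-valued-limit`), CONDITIONAL landing of the composition

The crux is verbatim Goldring–Koskivirta 2019, Thm. 3.5.5 (LDS unitary case, Mok's quasi-split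
`U_{K/F₀}(N)`).  Following the printed proof (op. cit. §11.1), this file proves it from FOUR named
facts, all theorems in print and all unproved in the tree (so the theorem is CONDITIONAL and does not
close the item): `GoldringKoskivirta2019_heckeFieldFinite` (§11.1 / Cor. 2.2.2: the eigenvalues of
`σ` generate a finite `E/ℚ_ℓ`), `Mok2014_weakBaseChange` (feeding the proved finiteness of the bad set,
`stub_almostAllUnramified`), `HarrisLanTaylorThorne2016_galoisRep_unitary_discreteSeries` (the
REGULAR case of the crux) and `GoldringKoskivirta2019_regularShadows` (Thm. 3.4.1 + Cor. 3.4.2 + §10 +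
§11.1: the eigensystem of `σ` modulo `ℓ^m` factors continuously through the Hecke algebra of regular
discrete-series cusp forms).  Everything on the Galois side — Taylor's pseudo-representation argument in
its algebra-valued form — is the proved Literature theorem
`exists_semisimple_galoisRep_of_algebraValuedLimit`; Satake multiplicity one is not assumed (two runs of
the construction + density of Frobenii, `charpoly_eq_of_frob_eq`).  References: W. Goldring,
J.-S. Koskivirta, Invent. Math. 217 (2019) Thm. 3.5.5, §11.1; R. Taylor, Duke Math. J. 63 (1991) §1;
M. Harris, K.-W. Lan, R. Taylor, J. Thorne, Res. Math. Sci. 3 (2016) Cor. 1.3; C. P. Mok, Mem. AMS 235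
(2015) Cor. 4.3.8.
-/

noncomputable section

open scoped BigOperators Polynomial Classical NumberField
open Polynomial IsDedekindDomain NumberField Filter Topology
open Literature.NumberTheory.Automorphic Literature.NumberTheory.GaloisRepresentations

set_option linter.dupNamespace false

namespace Summit.Langlands.Langlands.Theorems.GaloisRepOfUnitaryLDS.HeckeAlgebraValuedLimit

/-! ## The composition -/

section Composition

variable {F₀ K : Type} [Field F₀] [NumberField F₀] [Field K] [NumberField K] [Algebra F₀ K]
  {cK : K ≃ₐ[F₀] K} {N ℓ : ℕ} [Fact ℓ.Prime]
  {hcptK : isCompact_glFiniteIntegralLevel N K}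

/-- Two continuous framed Galois representations whose Frobenius characteristic polynomials agree
at every place outside a finite set have the same characteristic polynomial EVERYWHERE (Chebotarev
density of Frobenii, tree theorem `absoluteGaloisGroup.frobenius_dense`, and continuity of the
coefficients of `g ↦ charpoly ρ(g)`). [folklore] -/
theorem charpoly_eq_of_frob_eq {n : ℕ} (r r' : FramedGaloisRep K (PadicAlgCl ℓ) n)
    (T : Set (HeightOneSpectrum (𝓞 K))) (hT : T.Finite)
    (h : ∀ v ∉ T, ∃ Pv : (PadicAlgCl ℓ)[X], r.HasFrobCharpolyAt v Pv ∧ r'.HasFrobCharpolyAt v Pv)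
    (g : Field.absoluteGaloisGroup K) : FramedRep.charpoly r g = FramedRep.charpoly r' g := by
  have hD := absoluteGaloisGroup.frobenius_dense chebotarev_artinRep_holds K T hT
  ext k
  have hc := LadicLimit.continuous_coeff_charpoly r k
  have hc' := LadicLimit.continuous_coeff_charpoly r' k
  refine congr_fun (Continuous.ext_on hD hc hc' ?_) g
  rintro φ ⟨v, hv, 𝔓, h𝔓, hφ⟩
  obtain ⟨Pv, hr, hr'⟩ := h v hv
  simp only [hr 𝔓 h𝔓 φ hφ, hr' 𝔓 h𝔓 φ hφ]

/-- The crux for ONE datum and ONE selection `β₀` of base-change Satake parameters at the good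
places, from the four printed inputs: they give a semisimple `r` with the predicted polynomial of `β₀ u` at every good
`u`.  (`S :=` the bad set, finite by P3; `P u :=` the predicted polynomial of `β₀ u`, `E`-rational by
P2; the approximation families of K3 are the Galois representations (K2) of the regular shadows
(K1).) -/
theorem exists_rep_of_selection (h₁ : GoldringKoskivirta2019_heckeFieldFinite) (h₂ : Mok2014_weakBaseChange)
    (h₃ : HarrisLanTaylorThorne2016_galoisRep_unitary_discreteSeries) (h₄ : GoldringKoskivirta2019_regularShadows)
    (ι : PadicAlgCl ℓ ≃+* ℂ) (hF₀ : IsTotallyReal F₀)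
    (hK : Module.finrank F₀ K = 2) (hc : cK ≠ 1) (hKc : IsTotallyComplex K)
    (σ : UnitaryGroup.CuspidalAutomorphicRepData F₀ K cK N hcptK)
    (hLDS : ∀ (w : {w : InfinitePlace K // w.IsComplex}) (hw : cK • w.1 = w.1),
      ∃ (p q : ℕ) (d : LDSDatum p q),
        UnitaryGroup.IsNondegenerateLimitOfDiscreteSeriesAt F₀ K cK N (StdForm.antidiagonal N)
          hcptK σ.1 hw hc d)
    (hℓ : ∀ u : HeightOneSpectrum (𝓞 K), ((ℓ : ℕ) : 𝓞 K) ∈ u.asIdeal →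
      u.asIdeal.ramificationIdx ℤ = 1 ∧ UnitaryGroup.IsUnramifiedAt F₀ K cK N hcptK σ.1 u)
    (β₀ : HeightOneSpectrum (𝓞 K) → Multiset ℂ)
    (hβ₀ : ∀ u : HeightOneSpectrum (𝓞 K), ((ℓ : ℕ) : 𝓞 K) ∉ u.asIdeal →
      (∀ u' : HeightOneSpectrum (𝓞 K), u'.asIdeal.under ℤ = u.asIdeal.under ℤ →
        u'.asIdeal.ramificationIdx ℤ = 1 ∧ UnitaryGroup.IsUnramifiedAt F₀ K cK N hcptK σ.1 u') →
      UnitaryGroup.HasBaseChangeSatakeAt F₀ K cK N hcptK σ.1 u (β₀ u)) :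
    ∃ r : FramedGaloisRep K (PadicAlgCl ℓ) N, r.toGaloisRep.IsSemisimple ∧
      ∀ u : HeightOneSpectrum (𝓞 K), ((ℓ : ℕ) : 𝓞 K) ∉ u.asIdeal →
        (∀ u' : HeightOneSpectrum (𝓞 K), u'.asIdeal.under ℤ = u.asIdeal.under ℤ →
          u'.asIdeal.ramificationIdx ℤ = 1 ∧ UnitaryGroup.IsUnramifiedAt F₀ K cK N hcptK σ.1 u') →
        r.IsUnramifiedAt u ∧ r.HasFrobCharpolyAt u (arithFrobPolyOfSatake ι u.residueCard N (β₀ u)) := by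
  -- the bad set
  set S : Set (HeightOneSpectrum (𝓞 K)) := {u | ¬ (((ℓ : ℕ) : 𝓞 K) ∉ u.asIdeal ∧
    ∀ u' : HeightOneSpectrum (𝓞 K), u'.asIdeal.under ℤ = u.asIdeal.under ℤ →
      u'.asIdeal.ramificationIdx ℤ = 1 ∧ UnitaryGroup.IsUnramifiedAt F₀ K cK N hcptK σ.1 u')} with hSdef
  have hS : S.Finite := Summit.Langlands.Langlands.Theorems.GaloisRepOfUnitaryLDS.HeckeAlgebraValuedLimit.stub_almostAllUnramified h₂ F₀ K cK hK hc N ℓ hcptK σ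
  have hmemS : ∀ u, u ∉ S ↔ (((ℓ : ℕ) : 𝓞 K) ∉ u.asIdeal ∧
      ∀ u' : HeightOneSpectrum (𝓞 K), u'.asIdeal.under ℤ = u.asIdeal.under ℤ →
        u'.asIdeal.ramificationIdx ℤ = 1 ∧ UnitaryGroup.IsUnramifiedAt F₀ K cK N hcptK σ.1 u') := by
    intro u; simp [hSdef]
  -- rationality
  obtain ⟨E, hEfd, hE⟩ := h₁ F₀ K cK hF₀ hK hc hKc N ℓ ι hcptK σ hLDS hℓ
  haveI := hEfd
  set P : HeightOneSpectrum (𝓞 K) → (PadicAlgCl ℓ)[X] :=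
    fun u => arithFrobPolyOfSatake ι u.residueCard N (β₀ u) with hPdef
  have hP : ∀ v ∉ S, ∀ k : ℕ, (P v).coeff k ∈ E := by
    intro v hv k
    obtain ⟨hvℓ, hv'⟩ := (hmemS v).1 hv
    exact hE v (β₀ v) hvℓ hv' (hβ₀ v hvℓ hv') k
  -- the approximation families: Galois representations (K2) of the regular shadows (K1)
  have happrox : ∀ m : ℕ, ∃ (r : ℕ) (ρ' : Fin r → FramedGaloisRep K (PadicAlgCl ℓ) N)
      (Q : Fin r → HeightOneSpectrum (𝓞 K) → (PadicAlgCl ℓ)[X]) (δ : ℝ), 0 < δ ∧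
      (∀ i, ∀ v ∉ S, ((ℓ : ℕ) : 𝓞 K) ∉ v.asIdeal →
        (ρ' i).IsUnramifiedAt v ∧ (ρ' i).HasFrobCharpolyAt v (Q i v)) ∧
      ∀ F : MvPolynomial (HeightOneSpectrum (𝓞 K) × ℕ) ℤ,
        (∀ vk ∈ F.vars, vk.1 ∉ S ∧ ((ℓ : ℕ) : 𝓞 K) ∉ vk.1.asIdeal) →
        (∀ i, ‖MvPolynomial.aeval
            (fun vk : HeightOneSpectrum (𝓞 K) × ℕ => (Q i vk.1).coeff vk.2) F‖ ≤ δ) →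
          ‖MvPolynomial.aeval
              (fun vk : HeightOneSpectrum (𝓞 K) × ℕ => (P vk.1).coeff vk.2) F‖ ≤
            (ℓ : ℝ) ^ (-(m : ℤ)) := by
    intro m
    obtain ⟨r, σ', β', δ, hδ, hfam, hineq⟩ :=
      h₄ F₀ K cK hF₀ hK hc hKc N ℓ ι hcptK σ hLDS hℓ β₀ hβ₀ m
    have hgal : ∀ j : Fin r, ∃ rj : FramedGaloisRep K (PadicAlgCl ℓ) N,
        ∀ v ∉ S, ((ℓ : ℕ) : 𝓞 K) ∉ v.asIdeal → rj.IsUnramifiedAt v ∧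
          rj.HasFrobCharpolyAt v (arithFrobPolyOfSatake ι v.residueCard N (β' j v)) := by
      intro j
      obtain ⟨hDS, hℓj, hgoodj⟩ := hfam j
      obtain ⟨rj, -, hrj⟩ :=
        h₃ F₀ K cK hF₀ hK hc hKc N ℓ ι hcptK (σ' j) hDS hℓj
      refine ⟨rj, fun v hv hvℓ => ?_⟩
      obtain ⟨-, hv'⟩ := (hmemS v).1 hv
      obtain ⟨hv'j, hβ'j⟩ := hgoodj v hvℓ hv'
      exact hrj v (β' j v) hvℓ hv'j hβ'j
    choose ρ' hρ' using hgal
    refine ⟨r, ρ', fun j v => arithFrobPolyOfSatake ι v.residueCard N (β' j v), δ, hδ,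
      fun j v hv hvℓ => hρ' j v hv hvℓ, fun F hF hFδ => ?_⟩
    exact hineq F (fun uk huk => (hmemS uk.1).1 (hF uk huk).1) hFδ
  obtain ⟨ρ, hss, hρ⟩ := exists_semisimple_galoisRep_of_algebraValuedLimit K N ℓ E hEfd S hS P hP happrox
  refine ⟨ρ, hss, fun u hu hu' => ?_⟩
  exact hρ u ((hmemS u).2 ⟨hu, hu'⟩) hu

end Composition

/-- **The crux `GaloisRepOfUnitaryLDS` (= Goldring–Koskivirta 2019, Thm. 3.5.5, LDS unitary case)
from its four PRINTED INPUTS** — conditional theorem (the hypotheses are unproved named facts):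
`h₁` GK §11.1/Cor. 2.2.2 rationality, `h₂` Mok's weak base change (for the finiteness of the bad
set, via the proved `stub_almostAllUnramified`), `h₃` the regular case [HLTT] Cor. 1.3, `h₄` the
coherent-cohomology engine GK Thm. 3.4.1/§10 (regular shadows, algebra-valued); the whole Galois
side of GK §11.1 is the PROVED `exists_semisimple_galoisRep_of_algebraValuedLimit`.**  Choose a selection `β₀` of
base-change Satake parameters at the good places (they exist: a good place is in particular a place
where `σ` is unramified); `exists_rep_of_selection` gives `r`.  For an arbitrary parameter `β` at a
good `u`, run the construction again with the selection changed at `u` only; the two semisimple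
representations have the same Frobenius polynomials at every OTHER good place, hence (density +
continuity, `charpoly_eq_of_frob_eq`) the same characteristic polynomial at a Frobenius of `u`, i.e.
the predicted polynomials of `β₀ u` and of `β` coincide. -/
theorem GaloisRepOfUnitaryLDS_of_printedInputs (h₁ : GoldringKoskivirta2019_heckeFieldFinite)
    (h₂ : Mok2014_weakBaseChange) (h₃ : HarrisLanTaylorThorne2016_galoisRep_unitary_discreteSeries)
    (h₄ : GoldringKoskivirta2019_regularShadows) :
    Summit.Langlands.Langlands.Theses.QuadraticWindow.GaloisRepOfUnitaryLDS := by
  intro F₀ K _ _ _ _ _ cK hF₀ hK hc hKc N ℓ _ ι hcptK σ hLDS hℓ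
  classical
  -- a selection of base-change Satake parameters at the good places
  have hsel : ∀ u : HeightOneSpectrum (𝓞 K), ((ℓ : ℕ) : 𝓞 K) ∉ u.asIdeal →
      (∀ u' : HeightOneSpectrum (𝓞 K), u'.asIdeal.under ℤ = u.asIdeal.under ℤ →
        u'.asIdeal.ramificationIdx ℤ = 1 ∧ UnitaryGroup.IsUnramifiedAt F₀ K cK N hcptK σ.1 u') →
      ∃ β : Multiset ℂ, UnitaryGroup.HasBaseChangeSatakeAt F₀ K cK N hcptK σ.1 u β :=
    fun u _ hu' => (hu' u rfl).2
  let β₀ : HeightOneSpectrum (𝓞 K) → Multiset ℂ := fun u =>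
    if h : (((ℓ : ℕ) : 𝓞 K) ∉ u.asIdeal ∧
      ∀ u' : HeightOneSpectrum (𝓞 K), u'.asIdeal.under ℤ = u.asIdeal.under ℤ →
        u'.asIdeal.ramificationIdx ℤ = 1 ∧ UnitaryGroup.IsUnramifiedAt F₀ K cK N hcptK σ.1 u')
    then (hsel u h.1 h.2).choose else 0
  have hβ₀ : ∀ u : HeightOneSpectrum (𝓞 K), ((ℓ : ℕ) : 𝓞 K) ∉ u.asIdeal →
      (∀ u' : HeightOneSpectrum (𝓞 K), u'.asIdeal.under ℤ = u.asIdeal.under ℤ →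
        u'.asIdeal.ramificationIdx ℤ = 1 ∧ UnitaryGroup.IsUnramifiedAt F₀ K cK N hcptK σ.1 u') →
      UnitaryGroup.HasBaseChangeSatakeAt F₀ K cK N hcptK σ.1 u (β₀ u) := by
    intro u hu hu'
    simp only [β₀, dif_pos (And.intro hu hu')]
    exact (hsel u hu hu').choose_spec
  obtain ⟨r, hss, hr⟩ := exists_rep_of_selection h₁ h₂ h₃ h₄ ι hF₀ hK hc hKc σ hLDS hℓ β₀ hβ₀
  refine ⟨r, hss, fun u β hu hu' hβ => ⟨(hr u hu hu').1, ?_⟩⟩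
  -- second run, with the selection changed at `u`
  let β₁ : HeightOneSpectrum (𝓞 K) → Multiset ℂ := Function.update β₀ u β
  have hβ₁ : ∀ v : HeightOneSpectrum (𝓞 K), ((ℓ : ℕ) : 𝓞 K) ∉ v.asIdeal →
      (∀ u' : HeightOneSpectrum (𝓞 K), u'.asIdeal.under ℤ = v.asIdeal.under ℤ →
        u'.asIdeal.ramificationIdx ℤ = 1 ∧ UnitaryGroup.IsUnramifiedAt F₀ K cK N hcptK σ.1 u') →
      UnitaryGroup.HasBaseChangeSatakeAt F₀ K cK N hcptK σ.1 v (β₁ v) := by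
    intro v hv hv'
    by_cases hvu : v = u
    · subst hvu; simpa [β₁] using hβ
    · simpa [β₁, Function.update_of_ne hvu] using hβ₀ v hv hv'
  obtain ⟨r', -, hr'⟩ := exists_rep_of_selection h₁ h₂ h₃ h₄ ι hF₀ hK hc hKc σ hLDS hℓ β₁ hβ₁
  -- the two representations have the same Frobenius polynomials off the bad set and `u`
  set S : Set (HeightOneSpectrum (𝓞 K)) := {u | ¬ (((ℓ : ℕ) : 𝓞 K) ∉ u.asIdeal ∧
    ∀ u' : HeightOneSpectrum (𝓞 K), u'.asIdeal.under ℤ = u.asIdeal.under ℤ →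
      u'.asIdeal.ramificationIdx ℤ = 1 ∧ UnitaryGroup.IsUnramifiedAt F₀ K cK N hcptK σ.1 u')} with hSdef
  have hS : S.Finite := Summit.Langlands.Langlands.Theorems.GaloisRepOfUnitaryLDS.HeckeAlgebraValuedLimit.stub_almostAllUnramified h₂ F₀ K cK hK hc N ℓ hcptK σ
  have heq : ∀ g, FramedRep.charpoly r g = FramedRep.charpoly r' g := by
    refine charpoly_eq_of_frob_eq r r' (S ∪ {u}) (hS.union (Set.finite_singleton u)) ?_
    intro v hv
    simp only [Set.mem_union, Set.mem_singleton_iff, not_or, hSdef, Set.mem_setOf_eq, not_not] at hv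
    obtain ⟨⟨hvℓ, hv'⟩, hvu⟩ := hv
    refine ⟨arithFrobPolyOfSatake ι v.residueCard N (β₀ v), (hr v hvℓ hv').2, ?_⟩
    have e : β₁ v = β₀ v := by simp [β₁, Function.update_of_ne hvu]
    simpa [e] using (hr' v hvℓ hv').2
  -- read off at a Frobenius of `u`
  obtain ⟨𝔓, h𝔓⟩ := HeightOneSpectrum.primesAbove_nonempty u
  obtain ⟨φ, hφ⟩ := HeightOneSpectrum.exists_isArithFrobAt_of_mem_primesAbove_holds h𝔓
  have h0 : FramedRep.charpoly r φ = arithFrobPolyOfSatake ι u.residueCard N (β₀ u) :=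
    (hr u hu hu').2 𝔓 h𝔓 φ hφ
  have h1 : FramedRep.charpoly r' φ = arithFrobPolyOfSatake ι u.residueCard N β := by
    have := (hr' u hu hu').2 𝔓 h𝔓 φ hφ
    simpa [β₁] using this
  have hpoly : arithFrobPolyOfSatake ι u.residueCard N β =
      arithFrobPolyOfSatake ι u.residueCard N (β₀ u) := by
    rw [← h1, ← heq φ, h0]
  rw [hpoly]
  exact (hr u hu hu').2

end Summit.Langlands.Langlands.Theorems.GaloisRepOfUnitaryLDS.HeckeAlgebraValuedLimit

end
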